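import Literature.AlgebraicGeometry.Frobenioids.ModelFrobenioid
import HarnessLib

/-!
# Frobenioids I, Thm. 5.2 (i) / Cor. 5.4: functors INTO a model Frobenioid are determined, up to
# isomorphism, by their base, Frobenius-degree and divisor data

Mochizuki, *The geometry of Frobenioids I: the general theory*, Kyushu J. Math. **62** (2008)
293–400, §5, Theorem 5.2 (i) p. 100 (a morphism of the model Frobenioid of `(Φ, B, Div_B)` IS the quadruple
`(deg_Fr, Base, Div, u)` subject to relation (d)) and Corollary 5.4 p. 104 l. 2–6 ("there exists a 1-unique
functor `Ψ^rlf : C₁^rlf → C₂^rlf` that fits into a 1-commutative diagram …"; proof l. 21–22 "follows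
immediately from Corollaries 4.10; 4.11, (iii), (iv)") [cite: MochizukiFrdI2008, Thm. 5.2 (i) p.100]
[cite: MochizukiFrdI2008, Cor. 5.4 p.104].

PROOF-ONLY (seat abc-iut-L1-t10 gen 3; cell abc-iut, L1 sub-DAG W3 rows C54/L06 (the `Square` AT THE
DATA) and C54/L07 (`OneUniqueData`) of `plan/L1/SUBDAG-FrdI-Prop53-Cor54.md`).  The device behind both rows,
made explicit once: let `M₁`, `M₂` be the model Frobenioids of data `(Φ₁, B₁, Div_{B₁})` on `D₁` and
`(Φ₂, B₂, Div_{B₂})` on `D₂`, with `Div_{B₂}` INJECTIVE and `B₂` group-like (e.g. THE realification,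
`B₂ = ℝ · Φ^birat ↪ (Φ^rlf)^gp`, or the model of `(Φ, Φ^birat ↪ Φ^gp)` describing `C^un-tr`).  Then:

* `hom_eq_of_divB_injective` — a morphism of `M₂` between given objects is determined by
  `(deg_Fr, Base, Div)`: relation (d) pins `Div_{B₂}(u)`, hence `u`;
* `nonempty_iso_of_agree` — two functors `G₁, G₂ : M₁ ⥤ M₂`, `G₁` lying over a base functor
  `H : D₁ ⥤ D₂` (`γ₁ : G₁ ⋙ Base ≅ Base ⋙ H`), identified on bases by a NATURAL family of isomorphisms
  `b_X : Base(G₁ X) ⥲ Base(G₂ X)` (e.g. `b_X := γ₁ X ≫ (γ₂ X)⁻¹` for a second `γ₂`, `baseIdent_naturality`),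
  both preserving Frobenius degrees and agreeing — through `b` — on divisors of morphisms, ARE ISOMORPHIC.
  The object classes are pinned modulo `Div_{B₂}(B₂)`: the discrepancy `c_X := cls(G₁ X) / b_X^* cls(G₂ X)`
  satisfies `c_X ≡ Base(G₁ f)^* c_Y` along every morphism of Frobenius degree `1`
  (`discr_eq_of_degFr_eq_one`), and `c ≡ 1` at `(A, 1)` by its degree-`2` Frobenius endomorphism
  `(2, id, 0, 0)` (`discr_mem_of_frobenius`); hence at `(A, x)` along the pre-step `(1, id, x, 0) :
  (A, 1) → (A, x)` and at `(A, x − y)` along `(1, id, y, 0) : (A, x − y) → (A, x)` — every class being a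
  difference `x − y` of elements of `Φ₁`; the components `θ_X := (1, b_X, 0, u_X)` with
  `Div_{B₂}(u_X) = c_X` are natural by `hom_eq_of_divB_injective`.  Explicit-argument order of the main
  theorem: `(b) (hbn) (hdeg₂) (hdiv) (hdeg₁) (γ₁) (hB₂) (hinj)`.

No statement of the paper is restated or strengthened; nothing here bears on [IUTchIII].
-/

namespace Literature.AlgebraicGeometry.Frobenioids

open CategoryTheory Opposite

universe w₁ w₂ v₁ v₂ u₁ u₂

namespace ModelFrobenioid

section OneModel

variable {D : Type u₂} [Category.{v₂} D] {Φ B : Dᵒᵖ ⥤ CommMonCat.{w₂}} {DivB : B ⟶ monoidGp Φ}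

/-- **A morphism of a model Frobenioid with injective `Div_B` is determined by `(deg_Fr, Base, Div)`**:
relation (d) of Thm. 5.2 (i) pins `Div_B(u_φ)`. [cite: MochizukiFrdI2008, Thm. 5.2 (i) p.100] -/
theorem hom_eq_of_divB_injective (hinj : ∀ A : Dᵒᵖ, Function.Injective (divB Φ B DivB A))
    {X Y : ModelFrobenioid Φ B DivB} {φ ψ : X ⟶ Y} (h₁ : degFr φ = degFr ψ) (h₂ : baseMap φ = baseMap ψ)
    (h₃ : div φ = div ψ) : φ = ψ := by
  refine hom_ext h₁ h₂ h₃ (hinj _ ?_)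
  have hφ := rel φ
  have hψ := rel ψ
  rw [h₁, h₃, hψ, h₂] at hφ
  exact (mul_left_cancel hφ).symm

/-- Every class of a model Frobenioid is a quotient `x / y` of two elements of the monoid `Φ(A_D)`.
[cite: MochizukiFrdI2008, Thm. 5.2 (i) p.100] -/
theorem exists_cls_eq_div (X : ModelFrobenioid Φ B DivB) :
    ∃ x y : Φ.obj (op X.base),
      X.cls = Algebra.GrothendieckGroup.of x / Algebra.GrothendieckGroup.of y := by
  induction X.cls using Localization.induction_on with
  | H q =>
    refine ⟨q.1, q.2, eq_div_iff_mul_eq'.mpr ?_⟩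
    show Localization.mk q.1 q.2 * Localization.mk (q.2 : Φ.obj (op X.base)) 1 = Localization.mk q.1 1
    rw [Localization.mk_mul, Localization.mk_eq_mk_iff, Localization.r_iff_exists]
    exact ⟨1, by simp [mul_comm]⟩

/-- `Φ^birat(A) = Div_B(B(A))` is stable under inverses when `B` is group-like, hence under quotients.
[cite: MochizukiFrdI2008, Thm. 5.2 p.100] -/
theorem div_mem_biratSubmonoid (hB : ∀ (A : Dᵒᵖ) (b : B.obj A), IsUnit b) (A : Dᵒᵖ)
    {x y : Algebra.GrothendieckGroup (Φ.obj A)} (hx : x ∈ biratSubmonoid Φ B DivB A)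
    (hy : y ∈ biratSubmonoid Φ B DivB A) : x / y ∈ biratSubmonoid Φ B DivB A := by
  rw [div_eq_mul_inv]
  exact Submonoid.mul_mem _ hx (inv_mem_biratSubmonoid A (hB A) hy)

/-- `Φ^birat` is stable under the pull-backs `Φ(g)^gp` (naturality of `Div_B`).
[cite: MochizukiFrdI2008, Thm. 5.2 p.100] -/
theorem pullGp_mem_biratSubmonoid {X Y : D} (g : X ⟶ Y) {x : Algebra.GrothendieckGroup (Φ.obj (op Y))}
    (hx : x ∈ biratSubmonoid Φ B DivB (op Y)) : pullGp Φ g x ∈ biratSubmonoid Φ B DivB (op X) := by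
  obtain ⟨b, rfl⟩ := hx
  exact ⟨(B.map g.op).hom b, (pullGp_divB g b).symm⟩

/-- Dividing two instances of relation (d): from `x · z = a · s` and `p · z = q · t` in a commutative group,
`x / p = (a / q) · (s / t)`. [folklore] -/
private theorem div_eq_of_two_rels {G : Type*} [CommGroup G] {x p z a s q t : G}
    (h₁ : x * z = a * s) (h₂ : p * z = q * t) : x / p = a / q * (s / t) := by
  rw [eq_mul_inv_of_mul_eq h₁, eq_mul_inv_of_mul_eq h₂, mul_div_mul_right_eq_div, mul_div_mul_comm]

end OneModel

/-! ### Two functors into a model Frobenioid -/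

section TwoModels

variable {D₁ : Type u₁} [Category.{v₁} D₁] {D₂ : Type u₂} [Category.{v₂} D₂]
  {Φ₁ B₁ : D₁ᵒᵖ ⥤ CommMonCat.{w₁}} {DivB₁ : B₁ ⟶ monoidGp Φ₁}
  {Φ₂ B₂ : D₂ᵒᵖ ⥤ CommMonCat.{w₂}} {DivB₂ : B₂ ⟶ monoidGp Φ₂}
  {H : D₁ ⥤ D₂} {G₁ G₂ : ModelFrobenioid Φ₁ B₁ DivB₁ ⥤ ModelFrobenioid Φ₂ B₂ DivB₂}

/-- Naturality of the base identification `b_X := γ₁ X ≫ (γ₂ X)⁻¹ : Base(G₁ X) ⥲ Base(G₂ X)` of two functors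
lying over the same base functor `H`. [cite: MochizukiFrdI2008, Cor. 5.4 p.104] -/
theorem baseIdent_naturality (γ₁ : G₁ ⋙ baseFunctor Φ₂ B₂ DivB₂ ≅ baseFunctor Φ₁ B₁ DivB₁ ⋙ H)
    (γ₂ : G₂ ⋙ baseFunctor Φ₂ B₂ DivB₂ ≅ baseFunctor Φ₁ B₁ DivB₁ ⋙ H)
    {X Y : ModelFrobenioid Φ₁ B₁ DivB₁} (f : X ⟶ Y) :
    baseMap (G₁.map f) ≫ (γ₁.hom.app Y ≫ γ₂.inv.app Y : (G₁.obj Y).base ⟶ (G₂.obj Y).base) =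
      (γ₁.hom.app X ≫ γ₂.inv.app X : (G₁.obj X).base ⟶ (G₂.obj X).base) ≫ baseMap (G₂.map f) :=
  (γ₁ ≪≫ γ₂.symm).hom.naturality f

/-- Over a base-IDENTITY morphism `f` of `M₁` (same base object `A`), `Base(G₁ f) = γ₁ X ≫ (γ₁ Y)⁻¹`; in
particular it is invertible. [cite: MochizukiFrdI2008, Cor. 5.4 p.104] -/
theorem baseMap_map_of_baseMap_eq_id (γ₁ : G₁ ⋙ baseFunctor Φ₂ B₂ DivB₂ ≅ baseFunctor Φ₁ B₁ DivB₁ ⋙ H)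
    {A : D₁} {α α' : Algebra.GrothendieckGroup (Φ₁.obj (op A))}
    (f : (⟨A, α⟩ : ModelFrobenioid Φ₁ B₁ DivB₁) ⟶ ⟨A, α'⟩) (hf : baseMap f = 𝟙 A) :
    baseMap (G₁.map f) =
      (γ₁.hom.app ⟨A, α⟩ ≫ γ₁.inv.app ⟨A, α'⟩ : (G₁.obj ⟨A, α⟩).base ⟶ (G₁.obj ⟨A, α'⟩).base) := by
  have n := NatIso.naturality_2 γ₁ f
  have hH : (baseFunctor Φ₁ B₁ DivB₁ ⋙ H).map f = 𝟙 _ := by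
    show H.map (baseMap f) = 𝟙 (H.obj A)
    rw [hf]
    exact H.map_id A
  rw [hH] at n
  erw [Category.id_comp] at n
  exact n.symm

variable (b : ∀ X : ModelFrobenioid Φ₁ B₁ DivB₁, (G₁.obj X).base ≅ (G₂.obj X).base)
  (hbn : ∀ ⦃X Y : ModelFrobenioid Φ₁ B₁ DivB₁⦄ (f : X ⟶ Y),
    baseMap (G₁.map f) ≫ (b Y).hom = (b X).hom ≫ baseMap (G₂.map f))
  (hdeg₂ : ∀ ⦃X Y : ModelFrobenioid Φ₁ B₁ DivB₁⦄ (f : X ⟶ Y), degFr (G₂.map f) = degFr f)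
  (hdiv : ∀ ⦃X Y : ModelFrobenioid Φ₁ B₁ DivB₁⦄ (f : X ⟶ Y),
    div (G₁.map f) = (Φ₂.map (b X).hom.op).hom (div (G₂.map f)))

include hbn hdeg₂ hdiv

/-- Relation (d) for `G₂ f`, pulled back to `Base(G₁ X)` along `b_X` and rewritten with the divisor of `G₁ f`:
`(b_X^* cls(G₂ X))^{d} · Div(G₁ f) = Base(G₁ f)^* (b_Y^* cls(G₂ Y)) · Div_B(B(b_X) u_{G₂ f})`.
[cite: MochizukiFrdI2008, Thm. 5.2 (i) p.100] -/
theorem rel_pulled {X Y : ModelFrobenioid Φ₁ B₁ DivB₁} (f : X ⟶ Y) :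
    pullGp Φ₂ (b X).hom (G₂.obj X).cls ^ (degFr f : ℕ) * Algebra.GrothendieckGroup.of (div (G₁.map f)) =
      pullGp Φ₂ (baseMap (G₁.map f)) (pullGp Φ₂ (b Y).hom (G₂.obj Y).cls) *
        divB Φ₂ B₂ DivB₂ (op (G₁.obj X).base) ((B₂.map (b X).hom.op).hom (unit (G₂.map f))) := by
  have h := congrArg (pullGp Φ₂ (b X).hom) (rel (G₂.map f))
  rw [map_mul, map_pow, map_mul, pullGp_of, pullGp_divB, ← pullGp_comp, ← hbn f, pullGp_comp, hdeg₂,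
    ← hdiv] at h
  exact h

variable (hdeg₁ : ∀ ⦃X Y : ModelFrobenioid Φ₁ B₁ DivB₁⦄ (f : X ⟶ Y), degFr (G₁.map f) = degFr f)

include hdeg₁

/-- **The discrepancy along a morphism of Frobenius degree `1`**:
`c_X = Base(G₁ f)^* c_Y · (Div_B u_{G₁ f} / Div_B (B(b_X) u_{G₂ f}))`, where
`c_X := cls(G₁ X) / b_X^* cls(G₂ X)`. [cite: MochizukiFrdI2008, Cor. 5.4 p.104] -/
theorem discr_eq_of_degFr_eq_one {X Y : ModelFrobenioid Φ₁ B₁ DivB₁} (f : X ⟶ Y) (hf : degFr f = 1) :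
    (G₁.obj X).cls / pullGp Φ₂ (b X).hom (G₂.obj X).cls =
      pullGp Φ₂ (baseMap (G₁.map f)) ((G₁.obj Y).cls / pullGp Φ₂ (b Y).hom (G₂.obj Y).cls) *
        (divB Φ₂ B₂ DivB₂ (op (G₁.obj X).base) (unit (G₁.map f)) /
          divB Φ₂ B₂ DivB₂ (op (G₁.obj X).base) ((B₂.map (b X).hom.op).hom (unit (G₂.map f)))) := by
  have h₁ := rel (G₁.map f)
  have h₂ := rel_pulled b hbn hdeg₂ hdiv f
  rw [hdeg₁, hf, PNat.one_coe, pow_one] at h₁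
  rw [hf, PNat.one_coe, pow_one] at h₂
  rw [map_div]
  exact div_eq_of_two_rels h₁ h₂

variable (γ₁ : G₁ ⋙ baseFunctor Φ₂ B₂ DivB₂ ≅ baseFunctor Φ₁ B₁ DivB₁ ⋙ H)

include γ₁

/-- **The discrepancy at `(A, 1)` lies in `Div_B(B₂)`**, read off the degree-`2` Frobenius endomorphism
`(2, id, 0, 0)` of `(A, 1)`: relation (d) for its images gives `cls · Div = Div_B(u)` on both sides.
[cite: MochizukiFrdI2008, Cor. 5.4 p.104] -/
theorem discr_mem_of_frobenius (hB₂ : ∀ (A : D₂ᵒᵖ) (u : B₂.obj A), IsUnit u) (A : D₁) :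
    (G₁.obj ⟨A, 1⟩).cls / pullGp Φ₂ (b ⟨A, 1⟩).hom (G₂.obj ⟨A, 1⟩).cls ∈
      biratSubmonoid Φ₂ B₂ DivB₂ (op (G₁.obj ⟨A, 1⟩).base) := by
  -- the Frobenius endomorphism `(2, id, 0, 0)` of `(A, 1)`
  let f : (⟨A, 1⟩ : ModelFrobenioid Φ₁ B₁ DivB₁) ⟶ ⟨A, 1⟩ :=
    { degFr := 2
      base := 𝟙 A
      div := 1
      unit := 1
      rel := by
        show (1 : Algebra.GrothendieckGroup _) ^ _ * _ = pullGp Φ₁ (𝟙 A) 1 * _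
        rw [one_pow, map_one, map_one, map_one, mul_one] }
  have hβ : baseMap (G₁.map f) = 𝟙 _ := by
    rw [baseMap_map_of_baseMap_eq_id γ₁ f rfl]
    exact Iso.hom_inv_id_app γ₁ ⟨A, 1⟩
  -- relation (d) for `G₁ f`: `cls² · Div = cls · Div_B(u₁)`
  have h₁ := rel (G₁.map f)
  rw [hdeg₁, hβ, pullGp_id, show (((2 : ℕ+) : ℕ)) = 2 from rfl, pow_two, mul_assoc] at h₁
  -- the same for `G₂ f`, pulled back along `b`
  have h₂ := rel_pulled b hbn hdeg₂ hdiv f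
  rw [hβ, pullGp_id, show (((2 : ℕ+) : ℕ)) = 2 from rfl, pow_two, mul_assoc] at h₂
  rw [eq_mul_inv_of_mul_eq (mul_left_cancel h₁), eq_mul_inv_of_mul_eq (mul_left_cancel h₂),
    mul_div_mul_right_eq_div]
  exact div_mem_biratSubmonoid hB₂ _ ⟨_, rfl⟩ ⟨_, rfl⟩

/-- **Transport of the discrepancy along a base-identity morphism of Frobenius degree `1`** (both ways).
[cite: MochizukiFrdI2008, Cor. 5.4 p.104] -/
theorem discr_mem_iff_of_baseId (hB₂ : ∀ (A : D₂ᵒᵖ) (u : B₂.obj A), IsUnit u) {A : D₁}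
    {α α' : Algebra.GrothendieckGroup (Φ₁.obj (op A))}
    (f : (⟨A, α⟩ : ModelFrobenioid Φ₁ B₁ DivB₁) ⟶ ⟨A, α'⟩) (hf : degFr f = 1) (hb : baseMap f = 𝟙 A) :
    (G₁.obj ⟨A, α⟩).cls / pullGp Φ₂ (b ⟨A, α⟩).hom (G₂.obj ⟨A, α⟩).cls ∈
        biratSubmonoid Φ₂ B₂ DivB₂ (op (G₁.obj ⟨A, α⟩).base) ↔
      (G₁.obj ⟨A, α'⟩).cls / pullGp Φ₂ (b ⟨A, α'⟩).hom (G₂.obj ⟨A, α'⟩).cls ∈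
        biratSubmonoid Φ₂ B₂ DivB₂ (op (G₁.obj ⟨A, α'⟩).base) := by
  have e := discr_eq_of_degFr_eq_one b hbn hdeg₂ hdiv hdeg₁ f hf
  have hβ := baseMap_map_of_baseMap_eq_id γ₁ f hb
  have hs : divB Φ₂ B₂ DivB₂ (op (G₁.obj ⟨A, α⟩).base) (unit (G₁.map f)) /
      divB Φ₂ B₂ DivB₂ (op (G₁.obj ⟨A, α⟩).base) ((B₂.map (b ⟨A, α⟩).hom.op).hom (unit (G₂.map f))) ∈
        biratSubmonoid Φ₂ B₂ DivB₂ (op (G₁.obj ⟨A, α⟩).base) :=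
    div_mem_biratSubmonoid hB₂ _ ⟨_, rfl⟩ ⟨_, rfl⟩
  constructor
  · intro hX
    -- `Base(G₁ f)^* c_Y = c_X / s ∈ Div_B(B₂)`; pull back along the inverse base isomorphism
    have h1 : pullGp Φ₂ (baseMap (G₁.map f))
        ((G₁.obj ⟨A, α'⟩).cls / pullGp Φ₂ (b ⟨A, α'⟩).hom (G₂.obj ⟨A, α'⟩).cls) ∈
        biratSubmonoid Φ₂ B₂ DivB₂ (op (G₁.obj ⟨A, α⟩).base) := by
      rw [eq_mul_inv_of_mul_eq e.symm, ← div_eq_mul_inv]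
      exact div_mem_biratSubmonoid hB₂ _ hX hs
    have h2 := pullGp_mem_biratSubmonoid (Φ := Φ₂) (B := B₂) (DivB := DivB₂)
      (γ₁.hom.app ⟨A, α'⟩ ≫ γ₁.inv.app ⟨A, α⟩ : (G₁.obj ⟨A, α'⟩).base ⟶ (G₁.obj ⟨A, α⟩).base) h1
    rw [hβ, ← pullGp_comp] at h2
    have hid : ((γ₁.hom.app ⟨A, α'⟩ ≫ γ₁.inv.app ⟨A, α⟩ :
          (G₁.obj ⟨A, α'⟩).base ⟶ (G₁.obj ⟨A, α⟩).base) ≫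
        (γ₁.hom.app ⟨A, α⟩ ≫ γ₁.inv.app ⟨A, α'⟩ : (G₁.obj ⟨A, α⟩).base ⟶ (G₁.obj ⟨A, α'⟩).base)) =
        𝟙 _ := by
      rw [Category.assoc]
      erw [Iso.inv_hom_id_app_assoc]
      exact Iso.hom_inv_id_app γ₁ ⟨A, α'⟩
    rwa [hid, pullGp_id] at h2
  · intro hY
    rw [e]
    exact Submonoid.mul_mem _ (pullGp_mem_biratSubmonoid _ hY) hs

/-- **Two functors into a model Frobenioid agreeing on base, Frobenius degrees and divisors are
isomorphic** (`Div_{B₂}` injective, `B₂` group-like; source a model Frobenioid; `G₁` lying over a base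
functor `H` via `γ₁`, `G₂` identified with it on bases by a natural family `b`). Components
`θ_X = (1, b_X, 0, u_X)` with `Div_{B₂}(u_X) = c_X`, natural by `hom_eq_of_divB_injective`.
[cite: MochizukiFrdI2008, Cor. 5.4 p.104] -/
theorem nonempty_iso_of_agree (hB₂ : ∀ (A : D₂ᵒᵖ) (u : B₂.obj A), IsUnit u)
    (hinj : ∀ A : D₂ᵒᵖ, Function.Injective (divB Φ₂ B₂ DivB₂ A)) : Nonempty (G₁ ≅ G₂) := by
  -- (1) the discrepancy lies in `Div_B(B₂)` at every object
  have key : ∀ X : ModelFrobenioid Φ₁ B₁ DivB₁,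
      (G₁.obj X).cls / pullGp Φ₂ (b X).hom (G₂.obj X).cls ∈
        biratSubmonoid Φ₂ B₂ DivB₂ (op (G₁.obj X).base) := by
    rintro ⟨A, α⟩
    obtain ⟨x, y, hα⟩ := exists_cls_eq_div (⟨A, α⟩ : ModelFrobenioid Φ₁ B₁ DivB₁)
    dsimp only at x y hα
    -- the pre-steps `(A, 1) → (A, x)` and `(A, α) → (A, x)` with divisors `x`, `y`
    let g₁ : (⟨A, 1⟩ : ModelFrobenioid Φ₁ B₁ DivB₁) ⟶ ⟨A, Algebra.GrothendieckGroup.of x⟩ :=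
      { degFr := 1
        base := 𝟙 A
        div := x
        unit := 1
        rel := by
          show (1 : Algebra.GrothendieckGroup _) ^ _ * _ =
            pullGp Φ₁ (𝟙 A) (Algebra.GrothendieckGroup.of x) * _
          rw [one_pow, one_mul, pullGp_id, map_one, mul_one] }
    let g₂ : (⟨A, α⟩ : ModelFrobenioid Φ₁ B₁ DivB₁) ⟶ ⟨A, Algebra.GrothendieckGroup.of x⟩ :=
      { degFr := 1
        base := 𝟙 A
        div := y
        unit := 1
        rel := by
          show α ^ ((1 : ℕ+) : ℕ) * _ = pullGp Φ₁ (𝟙 A) (Algebra.GrothendieckGroup.of x) * _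
          rw [PNat.one_coe, pow_one, pullGp_id, map_one, mul_one, hα, div_mul_cancel] }
    have h₁ := discr_mem_of_frobenius b hbn hdeg₂ hdiv hdeg₁ γ₁ hB₂ A
    have h₂ := (discr_mem_iff_of_baseId b hbn hdeg₂ hdiv hdeg₁ γ₁ hB₂ g₁ rfl rfl).mp h₁
    exact (discr_mem_iff_of_baseId b hbn hdeg₂ hdiv hdeg₁ γ₁ hB₂ g₂ rfl rfl).mpr h₂
  -- … and, for the inverse components, `cls(G₂ X) / (b_X⁻¹)^* cls(G₁ X) = (b_X⁻¹)^* c_X⁻¹ ∈ Div_B(B₂)`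
  have key' : ∀ X : ModelFrobenioid Φ₁ B₁ DivB₁,
      (G₂.obj X).cls / pullGp Φ₂ (b X).inv (G₁.obj X).cls ∈
        biratSubmonoid Φ₂ B₂ DivB₂ (op (G₂.obj X).base) := by
    intro X
    have h := pullGp_mem_biratSubmonoid (Φ := Φ₂) (B := B₂) (DivB := DivB₂) (b X).inv
      (inv_mem_biratSubmonoid _ (hB₂ _) (key X))
    rwa [inv_div, map_div, ← pullGp_comp, Iso.inv_hom_id, pullGp_id] at h
  choose u hu using key
  choose u' hu' using key'
  -- (2) the components `θ_X = (1, b_X, 0, u_X)` and their inverses `(1, b_X⁻¹, 0, u'_X)`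
  let θ : ∀ X, G₁.obj X ⟶ G₂.obj X := fun X =>
    { degFr := 1
      base := (b X).hom
      div := 1
      unit := u X
      rel := by rw [PNat.one_coe, pow_one, map_one, mul_one, hu, mul_div_cancel] }
  let θ' : ∀ X, G₂.obj X ⟶ G₁.obj X := fun X =>
    { degFr := 1
      base := (b X).inv
      div := 1
      unit := u' X
      rel := by rw [PNat.one_coe, pow_one, map_one, mul_one, hu', mul_div_cancel] }
  have hθθ' : ∀ X, θ X ≫ θ' X = 𝟙 _ := fun X =>
    hom_eq_of_divB_injective hinj (mul_one 1) (b X).hom_inv_id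
      (by
        show (Φ₂.map (b X).hom.op).hom 1 * 1 ^ ((1 : ℕ+) : ℕ) = 1
        rw [map_one, one_pow, mul_one])
  have hθ'θ : ∀ X, θ' X ≫ θ X = 𝟙 _ := fun X =>
    hom_eq_of_divB_injective hinj (mul_one 1) (b X).inv_hom_id
      (by
        show (Φ₂.map (b X).inv.op).hom 1 * 1 ^ ((1 : ℕ+) : ℕ) = 1
        rw [map_one, one_pow, mul_one])
  -- (3) naturality: both composites have the same `(deg_Fr, Base, Div)`
  refine ⟨NatIso.ofComponents (fun X => ⟨θ X, θ' X, hθθ' X, hθ'θ X⟩) fun {X Y} f => ?_⟩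
  refine hom_eq_of_divB_injective hinj ?_ (hbn f) ?_
  · show 1 * degFr (G₁.map f) = degFr (G₂.map f) * 1
    rw [one_mul, mul_one, hdeg₁, hdeg₂]
  · show (Φ₂.map (baseMap (G₁.map f)).op).hom 1 * div (G₁.map f) ^ ((1 : ℕ+) : ℕ) =
      (Φ₂.map (b X).hom.op).hom (div (G₂.map f)) * 1 ^ (degFr (G₂.map f) : ℕ)
    rw [map_one, one_mul, PNat.one_coe, pow_one, one_pow, mul_one, hdiv]

end TwoModels

end ModelFrobenioid

end Literature.AlgebraicGeometry.Frobenioids
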